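import Mathlib
import Literature.Analysis.FluidPDE.VectorCalculus
import Literature.Analysis.FluidPDE.PressurePoisson
import Literature.Geometry.DiscreteGeometry.LayerShells
import Summits.NavierStokesRegularity.NavierStokesRegularity.Theorems.ThreadingFluxAzimuthalCartanDefs
import Summits.NavierStokesRegularity.NavierStokesRegularity.Theorems.ThreadingFluxAzimuthalCartanLocalCurlCurl
import Summits.NavierStokesRegularity.NavierStokesRegularity.Theorems.ThreadingFluxAzimuthalCartanConicalCorrespondence
import Summits.NavierStokesRegularity.NavierStokesRegularity.Theorems.ThreadingFluxAzimuthalCartanConicalHeadIntegral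
import Summits.NavierStokesRegularity.NavierStokesRegularity.Theorems.ThreadingFluxHorizonTowerZonalForm
import Summits.NavierStokesRegularity.NavierStokesRegularity.Theorems.ThreadingFluxHorizonTowerProfileFormulas
import Summits.NavierStokesRegularity.NavierStokesRegularity.Theorems.ThreadingFluxCentreJetPoloidalRepresentation
import HarnessLib

/-!
# Crux `PoloidalLiouville` (stmt-NavierStokesRegularity-1222, wall W1), crux idea «azimuthal-cartan-test» (ns-idea-15 g10):
# THE TANGENTIAL PART OF AN UNTHREADED `(−1)`-HOMOGENEOUS FIELD IS A GRADIENT ON CONVEX CONES — Šverák's `φ`, locally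

Support file (`--supports stmt-NavierStokesRegularity-1222`, helper; cell `ns-wall-extremal`, width hand ns-wall-eng-6 g8, 0 kit).  (Λ5b) of
the eng-6 lineage, second slice of the local converse of Šverák's conformal correspondence (`LiouvilleCone.correspondence`, C2; Λ5a
`ThreadingFluxAzimuthalCartanConicalHeadIntegral.lean` supplied the head `k₀`).

Šverák (arXiv:math/0604550 §4, after Lemma 1): "since `dv = 0` we can write `v = ∇φ` for a suitable smooth function `φ` on `S²`" — the
Poincaré lemma on the simply connected sphere; the tree has the `ℝ³ ∖ {0}` version (`Literature…Sverak2011.exists_tangential_potential`,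
four convex half-spaces glued).  HERE, the LOCAL statement behind it, KINEMATIC ONLY (no Navier–Stokes): for `u` differentiable at `x ≠ 0`
with Euler's relation `Du(x) x = −u(x)` and UNTHREADED at `x` (`⟪x, curl u(x)⟫ = 0`), the tangential part
`V(y) = u(y) − (⟪y, u(y)⟫/|y|²) y` has a SYMMETRIC derivative at `x`; hence on a CONVEX open `U ∌ 0` (Mathlib's Poincaré lemma for convex
sets, `Convex.exists_forall_hasFDerivAt_of_fderiv_symmetric` — cones minus the vertex are not convex, so the statement is local, on convex
sub-cones / balls; no spherical-cap Poincaré lemma is needed) it is a gradient: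

* `hasFDerivAt_tangential` — the derivative of `V` at `x` in closed form (`Du − φ·Id − x ⊗ (∇F/|x|² − 2F x/|x|⁴)`, `F = ⟪x,u⟫`, `φ = F/|x|²`,
  `∇F = x × curl u` from Λ5a `hasFDerivAt_inner_self`);
* ★ `inner_fderiv_tangential_symm_of_unthreaded` — `⟪DV(x) a, c⟫ = ⟪DV(x) c, a⟫` (the antisymmetric part of `Du` is `ω ×`, that of
  `x ⊗ ∇F/|x|²` is `((∇F × x)/|x|²) ×`, and these agree exactly when `ω = (∇F × x)/|x|²`, i.e. (Λ5a `curl_eq_of_unthreaded`) when the field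
  is unthreaded — Šverák's "`dv = 0`");
* ★★ `exists_tangential_potential_of_convex` — on a CONVEX open `U ∌ 0`, for `u ∈ C¹(U)` with Euler's relation and unthreadedness on `U`,
  there is `Φ` with `DΦ = ⟪V, ·⟫` on `U`;
* consequences for any such potential `Φ` (`HasFDerivAt Φ ⟪V y, ·⟫` on `U`): `gradient_potential` (`∇Φ = V`), `inner_self_gradient_potential`
  (`⟪y, ∇Φ⟫ = 0`: `Φ` is infinitesimally `0`-homogeneous), `eq_gradient_potential_add` (**`u = ∇Φ + ((w − 2)/|y|²) y`** with the conformal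
  weight `w = 2 + ⟪y, u⟫`), `divergence_tangential` (`div V = −F/|x|²` when `div u = 0`), and ★ `norm_sq_mul_laplacian_potential`
  (**`|x|² ΔΦ = 2 − w`**, the FIRST equation of Šverák's local system `{Δ_{S²}φ = 2 − w, −Δ_{S²}w + div(w∇φ) = 2k₀}`, for `u ∈ C²(U)`).

HONEST FRAME / LABEL (director-ns g19 p123, critic BATCH #25): SCOPE/SPECIAL-class support (steady `(−1)`-homogeneous unthreaded class — here
even without the steady equations), information-grade, explicit local vector calculus strictly below W1; closes no crux and no sketch Prop;
W1 movement 0; `PoloidalLiouville` (1222), C♯, I♭ and NS regularity are OPEN / NOT proved.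

## References
* V. Šverák, On Landau's solutions of the Navier–Stokes equations, J. Math. Sci. 179 (2011) 208–228, arXiv:math/0604550, §4. [Sverak2011]
* A. J. Majda, A. L. Bertozzi, Vorticity and Incompressible Flow (CUP 2002), §1.1 (vector identities). [MajdaBertozziCUP2002]
-/

-- the summit and its single sub-problem share the name (CONVENTIONS §1)
set_option linter.dupNamespace false

noncomputable section

namespace Summit.NavierStokesRegularity.NavierStokesRegularity.Theorems.PoloidalLiouville.AzimuthalCartan

open Set Function Filter Topology Metric
open scoped RealInnerProductSpace ContDiff
open Literature.Analysis.FluidPDE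
open Literature.Geometry.DiscreteGeometry (inner_fin3)
open Summit.NavierStokesRegularity.NavierStokesRegularity.Theorems.PoloidalLiouville.CentreJet
  (E3 laplacian_eq_divergence_of_hasFDerivAt_innerSL contDiffOn_two_of_hasFDerivAt_innerSL)
open Summit.NavierStokesRegularity.NavierStokesRegularity.Cruxes.ScarEnvelopeTypeI.ForcedTsai
  (gradient_eq_of_hasFDerivAt_innerSL fderiv_eq_innerSL_gradient')
open Summit.NavierStokesRegularity.NavierStokesRegularity.Theorems.PoloidalLiouville.HorizonTower (cross_fin3)
open Summit.NavierStokesRegularity.NavierStokesRegularity.Theorems.PoloidalLiouville.AzimuthalCartan.HalfSpace (hasFDerivAt_div)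
open Summit.NavierStokesRegularity.NavierStokesRegularity.Theorems.PoloidalLiouville.KinematicShadow.PointSource (divergence_id)

/-! ### The tangential part: derivative and symmetry -/

section Tangential

variable {u : E3 → E3} {x : E3} {D : E3 →L[ℝ] E3}

/-- The derivative of the tangential part `V(y) = u(y) − (⟪y,u(y)⟫/|y|²) y` at a point `x ≠ 0` where `u` has derivative `D` with Euler's
relation `D x = −u(x)`: `DV = D − (φ·Id + x ⊗ ℓ)`, `φ = F/|x|²`, `ℓ = ⟪x × curlCLM D, ·⟫/|x|² − (F/|x|⁴)·2⟪x, ·⟫`, `F = ⟪x, u x⟫`. -/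
theorem hasFDerivAt_tangential (hu : HasFDerivAt u D x) (hEu : D x = -u x) (hx : x ≠ 0) :
    HasFDerivAt (fun y : E3 => u y - (⟪y, u y⟫ / ‖y‖ ^ 2) • y)
      (D - ((⟪x, u x⟫ / ‖x‖ ^ 2) • ContinuousLinearMap.id ℝ E3 +
        ((‖x‖ ^ 2)⁻¹ • innerSL ℝ (cross x (curlCLM D)) - (⟪x, u x⟫ / (‖x‖ ^ 2) ^ 2) • (2 • innerSL ℝ x)).smulRight x)) x := by
  have hne : ‖x‖ ^ 2 ≠ 0 := pow_ne_zero 2 (norm_ne_zero_iff.mpr hx)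
  have hF := hasFDerivAt_inner_self hu hEu
  have hN : HasFDerivAt (fun y : E3 => ‖y‖ ^ 2) (2 • innerSL ℝ x) x := (hasStrictFDerivAt_norm_sq x).hasFDerivAt
  have hφ := hasFDerivAt_div hF hN hne
  have h := hu.sub (hφ.smul (hasFDerivAt_id x))
  refine h.congr_fderiv ?_
  simp only [id]

/-- ★ **The tangential part of an unthreaded `(−1)`-homogeneous field has a symmetric derivative** (Šverák's "`dv = 0`", pointwise):
if moreover `⟪x, curl u(x)⟫ = 0`, then `⟪DV(x) a, c⟫ = ⟪DV(x) c, a⟫` for all `a, c`. -/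
theorem inner_fderiv_tangential_symm_of_unthreaded (hu : HasFDerivAt u D x) (hEu : D x = -u x) (hx : x ≠ 0)
    (hrad : ⟪x, curlCLM D⟫ = 0) (a c : E3) :
    ⟪fderiv ℝ (fun y : E3 => u y - (⟪y, u y⟫ / ‖y‖ ^ 2) • y) x a, c⟫ =
      ⟪fderiv ℝ (fun y : E3 => u y - (⟪y, u y⟫ / ‖y‖ ^ 2) • y) x c, a⟫ := by
  have hne : ‖x‖ ^ 2 ≠ 0 := pow_ne_zero 2 (norm_ne_zero_iff.mpr hx)
  rw [(hasFDerivAt_tangential hu hEu hx).fderiv]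
  set b : E3 := curlCLM D with hb_def
  set g : E3 := cross x b with hg_def
  have hbg : b = (‖x‖ ^ 2)⁻¹ • cross g x := eq_inv_norm_sq_smul_cross_of_eq_cross hx hrad rfl
  -- the spin identity: `⟪D a, c⟫ − ⟪D c, a⟫ = ⟪c × b, a⟫ = (⟪c,x⟫⟪g,a⟫ − ⟪c,g⟫⟪x,a⟫)/|x|²`
  have hs : ⟪c, D a⟫ - ⟪D c, a⟫ = ⟪cross c b, a⟫ := by
    rw [hb_def]
    exact inner_apply_sub_inner_apply_eq D c a
  have hcb : ⟪cross c b, a⟫ = (‖x‖ ^ 2)⁻¹ * (⟪c, x⟫ * ⟪g, a⟫ - ⟪c, g⟫ * ⟪x, a⟫) := by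
    rw [hbg, Literature.Analysis.FluidPDE.cross_smul_right, cross_cross_eq, real_inner_smul_left, inner_sub_left, real_inner_smul_left,
      real_inner_smul_left]
  simp only [sub_apply, add_apply, smul_apply, ContinuousLinearMap.smulRight_apply, ContinuousLinearMap.id_apply, innerSL_apply_apply,
    inner_sub_left, inner_add_left, real_inner_smul_left, smul_eq_mul, nsmul_eq_mul, Nat.cast_ofNat]
  linear_combination hs + hcb - real_inner_comm (D a) c + (⟪x, u x⟫ / ‖x‖ ^ 2) * real_inner_comm a c +
    (‖x‖ ^ 2)⁻¹ * ⟪g, a⟫ * real_inner_comm x c - (‖x‖ ^ 2)⁻¹ * ⟪x, a⟫ * real_inner_comm g c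

/-- **The divergence of the tangential part**: if moreover `div u(x) = 0`, then `div V(x) = −⟪x, u x⟫/|x|²` (`div(φ y) = 3φ + Dφ(x) x`
and `Dφ(x) x = −2φ` for the `(−2)`-homogeneous `φ = F/|x|²`). -/
theorem divergence_tangential (hu : HasFDerivAt u D x) (hEu : D x = -u x) (hx : x ≠ 0) (hdiv : VectorCalculus.divergence u x = 0) :
    VectorCalculus.divergence (fun y : E3 => u y - (⟪y, u y⟫ / ‖y‖ ^ 2) • y) x = -⟪x, u x⟫ / ‖x‖ ^ 2 := by
  have hne : ‖x‖ ^ 2 ≠ 0 := pow_ne_zero 2 (norm_ne_zero_iff.mpr hx)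
  have hF := hasFDerivAt_inner_self hu hEu
  have hN : HasFDerivAt (fun y : E3 => ‖y‖ ^ 2) (2 • innerSL ℝ x) x := (hasStrictFDerivAt_norm_sq x).hasFDerivAt
  have hφ := hasFDerivAt_div hF hN hne
  have hR : DifferentiableAt ℝ (fun y : E3 => (⟪y, u y⟫ / ‖y‖ ^ 2) • y) x := (hφ.smul (hasFDerivAt_id x)).differentiableAt
  have hsub : VectorCalculus.divergence (fun y : E3 => u y - (⟪y, u y⟫ / ‖y‖ ^ 2) • y) x =
      VectorCalculus.divergence u x - VectorCalculus.divergence (fun y : E3 => (⟪y, u y⟫ / ‖y‖ ^ 2) • y) x := by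
    simp only [VectorCalculus.divergence]
    rw [fderiv_fun_sub hu.differentiableAt hR]
    push_cast
    exact map_sub _ _ _
  have hgx : ⟪cross x (curlCLM D), x⟫ = 0 := by
    obtain ⟨c0, c1, c2⟩ := cross_fin3 x (curlCLM D)
    rw [inner_fin3, c0, c1, c2]
    ring
  rw [hsub, hdiv, HorizonTower.divergence_smul_apply (u := fun y : E3 => y) hφ.differentiableAt differentiableAt_fun_id, divergence_id,
    hφ.fderiv]
  simp only [sub_apply, smul_apply, innerSL_apply_apply, smul_eq_mul, nsmul_eq_mul, Nat.cast_ofNat, hgx, real_inner_self_eq_norm_sq]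
  field_simp
  ring

end Tangential

/-! ### The potential on convex open cones -/

section Potential

variable {U : Set E3} {u : E3 → E3} {x : E3}

/-- ★★ **The tangential part is a gradient on a CONVEX open cone** (Šverák's "`dv = 0` ⇒ `v = ∇φ`", locally; Mathlib's Poincaré lemma
for convex open sets).  If `U` is open and convex with `0 ∉ U`, and `u ∈ C¹(U)` satisfies Euler's relation `Du(y) y = −u(y)` and is
UNTHREADED (`⟪y, curl u(y)⟫ = 0`) on `U`, then there is `Φ : ℝ³ → ℝ` with `DΦ(y) = ⟪u(y) − (⟪y,u(y)⟫/|y|²) y, ·⟫` for all `y ∈ U`. -/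
theorem exists_tangential_potential_of_convex (hU : IsOpen U) (hUc : Convex ℝ U) (h0 : ∀ y ∈ U, y ≠ 0) (hu : ContDiffOn ℝ 1 u U)
    (hEu : ∀ y ∈ U, fderiv ℝ u y y = -u y) (hrad : ∀ y ∈ U, ⟪y, curl u y⟫ = 0) :
    ∃ Φ : E3 → ℝ, ∀ y ∈ U, HasFDerivAt Φ (innerSL ℝ (u y - (⟪y, u y⟫ / ‖y‖ ^ 2) • y)) y := by
  set V : E3 → E3 := fun y => u y - (⟪y, u y⟫ / ‖y‖ ^ 2) • y with hV_def
  have hud : ∀ y ∈ U, HasFDerivAt u (fderiv ℝ u y) y := fun y hy =>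
    ((hu.contDiffAt (hU.mem_nhds hy)).differentiableAt one_ne_zero).hasFDerivAt
  have hVd : ∀ y ∈ U, HasFDerivAt V (fderiv ℝ V y) y := fun y hy =>
    (hasFDerivAt_tangential (hud y hy) (hEu y hy) (h0 y hy)).differentiableAt.hasFDerivAt
  have hωd : ∀ y ∈ U, HasFDerivAt (fun y => innerSL ℝ (V y)) ((innerSL ℝ : E3 →L[ℝ] E3 →L[ℝ] ℝ).comp (fderiv ℝ V y)) y :=
    fun y hy => (innerSL ℝ : E3 →L[ℝ] E3 →L[ℝ] ℝ).hasFDerivAt.comp y (hVd y hy)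
  have hωD : DifferentiableOn ℝ (fun y => innerSL ℝ (V y)) U := fun y hy => (hωd y hy).differentiableAt.differentiableWithinAt
  have hsym : ∀ a ∈ U, ∀ v w : E3, fderiv ℝ (fun y => innerSL ℝ (V y)) a v w = fderiv ℝ (fun y => innerSL ℝ (V y)) a w v := by
    intro a ha v w
    rw [(hωd a ha).fderiv]
    simp only [ContinuousLinearMap.coe_comp, Function.comp_apply, innerSL_apply_apply]
    have hcurl : ⟪a, curlCLM (fderiv ℝ u a)⟫ = 0 := by
      rw [← curl_eq_curlCLM]
      exact hrad a ha
    exact inner_fderiv_tangential_symm_of_unthreaded (hud a ha) (hEu a ha) (h0 a ha) hcurl v w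
  exact hUc.exists_forall_hasFDerivAt_of_fderiv_symmetric hU hωD hsym

/-! ### Consequences for any tangential potential -/

variable {Φ : E3 → ℝ}

/-- `∇Φ = V` on `U`. -/
theorem gradient_potential (hΦ : ∀ y ∈ U, HasFDerivAt Φ (innerSL ℝ (u y - (⟪y, u y⟫ / ‖y‖ ^ 2) • y)) y) (hx : x ∈ U) :
    gradient Φ x = u x - (⟪x, u x⟫ / ‖x‖ ^ 2) • x :=
  gradient_eq_of_hasFDerivAt_innerSL (hΦ x hx)

/-- `⟪x, ∇Φ(x)⟫ = 0`: the potential is infinitesimally `0`-homogeneous (Šverák's `Φ(t x) = Φ(x)`, locally). -/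
theorem inner_self_gradient_potential (hΦ : ∀ y ∈ U, HasFDerivAt Φ (innerSL ℝ (u y - (⟪y, u y⟫ / ‖y‖ ^ 2) • y)) y) (hx : x ∈ U)
    (hx0 : x ≠ 0) : ⟪x, gradient Φ x⟫ = 0 := by
  have hne : ‖x‖ ^ 2 ≠ 0 := pow_ne_zero 2 (norm_ne_zero_iff.mpr hx0)
  rw [gradient_potential hΦ hx, inner_sub_right, inner_smul_right, real_inner_self_eq_norm_sq, div_mul_cancel₀ _ hne, sub_self]

/-- ★ **`u = ∇Φ + ((w − 2)/|x|²) x`** with the conformal weight `w = 2 + ⟪x, u⟫` (Šverák's `u = ∇φ + f σ`, `w = 2 + f`, on the cone). -/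
theorem eq_gradient_potential_add (hΦ : ∀ y ∈ U, HasFDerivAt Φ (innerSL ℝ (u y - (⟪y, u y⟫ / ‖y‖ ^ 2) • y)) y) (hx : x ∈ U) :
    u x = gradient Φ x + ((2 + ⟪x, u x⟫ - 2) / ‖x‖ ^ 2) • x := by
  rw [gradient_potential hΦ hx, add_sub_cancel_left, sub_add_cancel]

/-- The potential is `C²` on `U` when `u ∈ C²(U)` (`0 ∉ U`). -/
theorem contDiffOn_potential (hU : IsOpen U) (h0 : ∀ y ∈ U, y ≠ 0) (hu : ContDiffOn ℝ 2 u U)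
    (hΦ : ∀ y ∈ U, HasFDerivAt Φ (innerSL ℝ (u y - (⟪y, u y⟫ / ‖y‖ ^ 2) • y)) y) : ContDiffOn ℝ 2 Φ U := by
  have hF : ContDiffOn ℝ 2 (fun y : E3 => ⟪y, u y⟫) U := contDiffOn_id.inner ℝ hu
  have hN : ContDiffOn ℝ 2 (fun y : E3 => ‖y‖ ^ 2) U := (contDiff_norm_sq ℝ).contDiffOn
  have hV : ContDiffOn ℝ 2 (fun y : E3 => u y - (⟪y, u y⟫ / ‖y‖ ^ 2) • y) U :=
    hu.sub ((hF.div hN fun y hy => pow_ne_zero 2 (norm_ne_zero_iff.mpr (h0 y hy))).smul contDiffOn_id)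
  exact contDiffOn_two_of_hasFDerivAt_innerSL hU (hV.of_le (by norm_num)) hΦ

/-- ★ **`|x|² ΔΦ = 2 − w`** — the FIRST equation of Šverák's local system (`Δ_{S²}φ = 2 − w`, `w = 2 + ⟪x, u⟫`; in `ℝ³`, `Δ_{S²}φ = |x|²ΔΦ`
for the `0`-homogeneous `Φ`): for `u ∈ C¹(U)` divergence-free with Euler's relation on the open `U ∌ 0` and any tangential potential `Φ`. -/
theorem norm_sq_mul_laplacian_potential (hU : IsOpen U) (h0 : ∀ y ∈ U, y ≠ 0) (hu : ContDiffOn ℝ 1 u U)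
    (hdiv : ∀ y ∈ U, VectorCalculus.divergence u y = 0) (hEu : ∀ y ∈ U, fderiv ℝ u y y = -u y)
    (hΦ : ∀ y ∈ U, HasFDerivAt Φ (innerSL ℝ (u y - (⟪y, u y⟫ / ‖y‖ ^ 2) • y)) y) (hx : x ∈ U) :
    ‖x‖ ^ 2 * Laplacian.laplacian Φ x = 2 - (2 + ⟪x, u x⟫) := by
  have hne : ‖x‖ ^ 2 ≠ 0 := pow_ne_zero 2 (norm_ne_zero_iff.mpr (h0 x hx))
  have hud : HasFDerivAt u (fderiv ℝ u x) x := ((hu.contDiffAt (hU.mem_nhds hx)).differentiableAt one_ne_zero).hasFDerivAt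
  have hVt := hasFDerivAt_tangential hud (hEu x hx) (h0 x hx)
  have hn0 : ‖x‖ ≠ 0 := norm_ne_zero_iff.mpr (h0 x hx)
  rw [laplacian_eq_divergence_of_hasFDerivAt_innerSL hU hΦ hx hVt.differentiableAt,
    divergence_tangential hud (hEu x hx) (h0 x hx) (hdiv x hx)]
  field_simp
  ring

end Potential

end Summit.NavierStokesRegularity.NavierStokesRegularity.Theorems.PoloidalLiouville.AzimuthalCartan

end
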